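import Summits.FinalStateConjecture.FinalStateConjecture.Theorems.StarvedNecksGapDecaySufficesStubAssembly

/-!
# Stub `stub_certificateBookkeeping` (B of line `Sketch`, crux `GapDecaySuffices`, skeleton v10) — file 1: DEFINITIONS

The residual sub-statements of the cross-hole bookkeeping (B) = `…Assembly.CertificateBookkeeping`
(the v5 `NeckCertificate` K1–K12 of the parity-relabelled decomposition `relabelEach d P` from the
per-hole data).  All four have EXACTLY the antecedents of `CertificateBookkeeping` (admissible datum,
MGHD, `O = exteriorOf`, fully honest anchored `C⁴` decomposition `d` with `0 < d.N`, parity data, and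
per hole: admissible profile `ρ'ᵢ`, gap certificate G0–G5 above `3·(16ρ'ᵢ) + 2`, location of the collar
`[1.1ρ'ᵢ, 46ρ'ᵢ]`, single-hole certificate of the relabelled hole); only the conclusions differ.  The
reduction `certificateBookkeeping_of : GapTubesExclusive → FlatInnerCofinal → HoleSlabsCofinal →
RimEscape → CertificateBookkeeping` is the proof files of this stub.

* `GapTubesExclusive` — the UNLOCATED part of K10 (crux NOTES F12): the gap chart `Ψgᵢ` of hole `i`
  maps no late DEEP gap-tube point (`rᵢ ≤ 5ρ'ᵢ(x⁰)`: the near zone, the annulus `R₁ + 1 < rᵢ < 1.1ρ'ᵢ`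
  that no set-level clause locates, and the inner collar) onto the `Ψgⱼ`-image of a late deep gap-tube
  point of another hole `j`, nor onto the flat image of a late point of hole `j`'s analysis collar
  `4ρ'ⱼ(y⁰) ≤ rⱼ y ≤ 40ρ'ⱼ(y⁰)`.  (The OUTER case of K10 — two flat images — is proved from cone
  separation; the inner cases are these two clauses after the single-hole certificates' inner location.)
* `FlatInnerCofinal` — the unlocated part of K12 for the FLAT chart: every late flat point (in
  particular a flat-domain point inside `4ρ'ⱼ`, where nothing locates `Φ`) lies in the causal past of a
  late flat ANCHOR point (`Te ≤ z⁰`, `4ρ'ⱼ(z⁰) ≤ rⱼ z` for every `j`), for every late threshold `Te`.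
* `HoleSlabsCofinal` — the unlocated part of K12 for the INPUT hole charts: for every late flat
  threshold `Te` there is a hole time after which every far point (`R₀ + 1 ≤ rᵢ`) of the input chart
  `Ψᵢ` lies in the causal past of a flat anchor point later than `Te` (the near zone `rᵢ ≤ R₀ + 1` is
  the re-gauged chart's by K6 and needs nothing; earlier points are lifted by `Hc`(2)).
* `RimEscape` — the K12 FRONTIER brick (true and self-contained: asymptotic cone control of `Φ` from the
  flat `C⁴` certificate + `Hc`(4), outward rays, cone separation, sublinearity): a late flat point far
  from every hole (`9ρ'ⱼ(y⁰) ≤ rⱼ y`) at flat time `y⁰ ≤ T` lies in the causal past of the FAR part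
  `{z⁰ = T, 5ρ'ⱼ(T) < rⱼ z ∀ j}` of the flat slab at time `T`.

No `sorry`, standard axioms; statements only (namespace `…Theorems.GapDecaySuffices.Bookkeeping`).
-/

noncomputable section

open scoped Manifold ContDiff Topology ENNReal
open Filter Set Topology Literature.Geometry.Lorentzian

namespace Summit.FinalStateConjecture.FinalStateConjecture.Theorems.GapDecaySuffices.Bookkeeping

-- justified lint debt: the problem namespace repeats the summit name (`FinalStateConjecture.FinalStateConjecture`)
set_option linter.dupNamespace false

open Location.AnchoredV2 (HonestCore HonestFar DistinctVelocities TubeAnchoredR)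
open Relabel (ParityDatum relabelMotion relabelChart relabelEach)
open Assembly (GapCert Located AdmissibleProfile SingleHoleCert)

/-- **Residual (K10, unlocated part): gap tubes of different holes are exclusive.**  With the
antecedents of `CertificateBookkeeping`: after some time `τe`, for holes `i ≠ j`, (1) the `Ψgᵢ`-image of
a late deep gap-tube point of hole `i` (`τe ≤ tᵢ x`, `τe ≤ x⁰`, `rᵢ x ≤ 5ρ'ᵢ(x⁰)`) is not the
`Ψgⱼ`-image of a late deep gap-tube point of hole `j`; (2) nor is it the flat image of a late point of
hole `j`'s analysis collar `4ρ'ⱼ(y⁰) ≤ rⱼ y ≤ 40ρ'ⱼ(y⁰)`.  (Crux NOTES F12: derivable only from an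
upstream NESTING clause `Ψgᵢ '' tube ⊆ Ψᵢ '' late cell` plus growing-radius separation of the input
hole charts, or from curvature invariants; true for honest inputs.) -/
def GapTubesExclusive : Prop :=
  ∀ (X : Type) [TopologicalSpace X] [ChartedSpace E3 X] [IsManifold (𝓡 3) ∞ X] [ConnectedSpace X]
    (D : InitialDataSet (𝓡 3) X), D ∈ admissibleVacuumData X →
    ∀ 𝒟 : VacuumCauchyDevelopment D, 𝒟.IsMaximal →
    ∀ (O : Set 𝒟.carrier) (d : FinalStateDecomposition 𝒟.toSpacetime O 4) (R₀ : ℝ),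
      O = exteriorOf 𝒟.toCauchyDevelopment d.charted →
      HonestCore 𝒟.toSpacetime O 4 d R₀ → HonestFar 𝒟.toSpacetime O 4 d R₀ →
      DistinctVelocities 𝒟.toSpacetime O 4 d → TubeAnchoredR d R₀ → 0 < d.N →
      ∀ (P : ∀ i, ParityDatum (d.motion i).1) (ρ' : Fin d.N → ℝ → ℝ) (τm R₁ τ₁ τ₂ τn : Fin d.N → ℝ)
        (W κ Rc κ' : Fin d.N → ℝ → ℝ) (Ψg : ∀ i, (d.background i).domain → 𝒟.carrier)
        (Ψa : ∀ i, (boostedKerrBackground (relabelMotion (P i)) (d.motion i).2 (d.mass i)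
          (d.spin i)).domain → 𝒟.carrier),
        (∀ i, AdmissibleProfile d R₀ i (ρ' i) (τm i)) →
        (∀ i, GapCert d R₀ i (fun s ↦ 3 * (16 * ρ' i s) + 2) (R₁ i) (τ₁ i) (W i) (Ψg i)) →
        (∀ i, τ₁ i ≤ τ₂ i ∧ Tendsto (κ i) atTop (𝓝 0) ∧
          Located d i (ρ' i) (τ₁ i) (W i) (Ψg i) (τ₂ i) (κ i) (11 / 10) 46) →
        (∀ i, SingleHoleCert d R₀ i (P i) (ρ' i) (τ₁ i) (W i) (Ψg i) (τn i) (Rc i) (κ' i) (Ψa i)) →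
        ∃ τe : ℝ, ∀ i j : Fin d.N, i ≠ j →
          (∀ (x : (d.background i).domain) (x' : (d.background j).domain),
            τe ≤ (d.background i).time x.1 → τe ≤ x.1 0 →
            (d.background i).radius x.1 ≤ 5 * ρ' i (x.1 0) →
            τe ≤ (d.background j).time x'.1 → τe ≤ x'.1 0 →
            (d.background j).radius x'.1 ≤ 5 * ρ' j (x'.1 0) → Ψg i x ≠ Ψg j x') ∧
          (∀ (x : (d.background i).domain) (y : d.flatDomain),
            τe ≤ (d.background i).time x.1 → τe ≤ x.1 0 →
            (d.background i).radius x.1 ≤ 5 * ρ' i (x.1 0) →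
            τe ≤ y.1 0 → 4 * ρ' j (y.1 0) ≤ (d.background j).radius y.1 →
            (d.background j).radius y.1 ≤ 40 * ρ' j (y.1 0) → Ψg i x ≠ d.flatChart y)

/-- **Residual (K12, flat chart): late flat points are causally below late flat anchors.**  With the
antecedents of `CertificateBookkeeping`: there is `Te₀` such that for every threshold `Te ≥ Te₀`, the
flat image of every flat-domain point `y` with `Te ≤ y⁰` lies in the causal past of the flat image of
the ANCHOR set `{z | Te ≤ z⁰ ∧ ∀ j, 4ρ'ⱼ(z⁰) ≤ rⱼ z}` (trivial for anchor points; the content is the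
flat domain inside `4ρ'ⱼ`, including its components inside the excised tubes, which no clause of the
structure, `Hc`, `Hf` or the gap certificates locates — crux NOTES F12; true for honest inputs, whose
inner flat region lies in the domain of outer communications). -/
def FlatInnerCofinal : Prop :=
  ∀ (X : Type) [TopologicalSpace X] [ChartedSpace E3 X] [IsManifold (𝓡 3) ∞ X] [ConnectedSpace X]
    (D : InitialDataSet (𝓡 3) X), D ∈ admissibleVacuumData X →
    ∀ 𝒟 : VacuumCauchyDevelopment D, 𝒟.IsMaximal →
    ∀ (O : Set 𝒟.carrier) (d : FinalStateDecomposition 𝒟.toSpacetime O 4) (R₀ : ℝ),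
      O = exteriorOf 𝒟.toCauchyDevelopment d.charted →
      HonestCore 𝒟.toSpacetime O 4 d R₀ → HonestFar 𝒟.toSpacetime O 4 d R₀ →
      DistinctVelocities 𝒟.toSpacetime O 4 d → TubeAnchoredR d R₀ → 0 < d.N →
      ∀ (P : ∀ i, ParityDatum (d.motion i).1) (ρ' : Fin d.N → ℝ → ℝ) (τm R₁ τ₁ τ₂ τn : Fin d.N → ℝ)
        (W κ Rc κ' : Fin d.N → ℝ → ℝ) (Ψg : ∀ i, (d.background i).domain → 𝒟.carrier)
        (Ψa : ∀ i, (boostedKerrBackground (relabelMotion (P i)) (d.motion i).2 (d.mass i)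
          (d.spin i)).domain → 𝒟.carrier),
        (∀ i, AdmissibleProfile d R₀ i (ρ' i) (τm i)) →
        (∀ i, GapCert d R₀ i (fun s ↦ 3 * (16 * ρ' i s) + 2) (R₁ i) (τ₁ i) (W i) (Ψg i)) →
        (∀ i, τ₁ i ≤ τ₂ i ∧ Tendsto (κ i) atTop (𝓝 0) ∧
          Located d i (ρ' i) (τ₁ i) (W i) (Ψg i) (τ₂ i) (κ i) (11 / 10) 46) →
        (∀ i, SingleHoleCert d R₀ i (P i) (ρ' i) (τ₁ i) (W i) (Ψg i) (τn i) (Rc i) (κ' i) (Ψa i)) →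
        ∃ Te₀ : ℝ, ∀ Te : ℝ, Te₀ ≤ Te → ∀ y : d.flatDomain, Te ≤ y.1 0 →
          d.flatChart y ∈ 𝒟.toSpacetime.metric.causalPast 𝒟.toSpacetime.timeOrientation
            (d.flatChart '' {z : d.flatDomain | Te ≤ z.1 0 ∧
              ∀ j, 4 * ρ' j (z.1 0) ≤ (d.background j).radius z.1})

/-- **Residual (K12, input hole charts): late far hole-chart points are causally below late flat
anchors.**  With the antecedents of `CertificateBookkeeping`: there is `Te₀` such that for every flat
threshold `Te ≥ Te₀` there is a hole time `τe` after which the input chart `Ψᵢ` maps every point of its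
far region `R₀ + 1 ≤ rᵢ` into the causal past of the flat image of the anchor set
`{z | Te ≤ z⁰ ∧ ∀ j, 4ρ'ⱼ(z⁰) ≤ rⱼ z}` (the far leaves of the input hole charts beyond `R₀ + 1` are
located by no clause — crux NOTES F5(i)/F12; true for honest inputs). -/
def HoleSlabsCofinal : Prop :=
  ∀ (X : Type) [TopologicalSpace X] [ChartedSpace E3 X] [IsManifold (𝓡 3) ∞ X] [ConnectedSpace X]
    (D : InitialDataSet (𝓡 3) X), D ∈ admissibleVacuumData X →
    ∀ 𝒟 : VacuumCauchyDevelopment D, 𝒟.IsMaximal →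
    ∀ (O : Set 𝒟.carrier) (d : FinalStateDecomposition 𝒟.toSpacetime O 4) (R₀ : ℝ),
      O = exteriorOf 𝒟.toCauchyDevelopment d.charted →
      HonestCore 𝒟.toSpacetime O 4 d R₀ → HonestFar 𝒟.toSpacetime O 4 d R₀ →
      DistinctVelocities 𝒟.toSpacetime O 4 d → TubeAnchoredR d R₀ → 0 < d.N →
      ∀ (P : ∀ i, ParityDatum (d.motion i).1) (ρ' : Fin d.N → ℝ → ℝ) (τm R₁ τ₁ τ₂ τn : Fin d.N → ℝ)
        (W κ Rc κ' : Fin d.N → ℝ → ℝ) (Ψg : ∀ i, (d.background i).domain → 𝒟.carrier)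
        (Ψa : ∀ i, (boostedKerrBackground (relabelMotion (P i)) (d.motion i).2 (d.mass i)
          (d.spin i)).domain → 𝒟.carrier),
        (∀ i, AdmissibleProfile d R₀ i (ρ' i) (τm i)) →
        (∀ i, GapCert d R₀ i (fun s ↦ 3 * (16 * ρ' i s) + 2) (R₁ i) (τ₁ i) (W i) (Ψg i)) →
        (∀ i, τ₁ i ≤ τ₂ i ∧ Tendsto (κ i) atTop (𝓝 0) ∧
          Located d i (ρ' i) (τ₁ i) (W i) (Ψg i) (τ₂ i) (κ i) (11 / 10) 46) →
        (∀ i, SingleHoleCert d R₀ i (P i) (ρ' i) (τ₁ i) (W i) (Ψg i) (τn i) (Rc i) (κ' i) (Ψa i)) →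
        ∃ Te₀ : ℝ, ∀ Te : ℝ, Te₀ ≤ Te → ∃ τe : ℝ, ∀ (i : Fin d.N) (x : (d.background i).domain),
          τe ≤ (d.background i).time x.1 → R₀ + 1 ≤ (d.background i).radius x.1 →
          d.chart i x ∈ 𝒟.toSpacetime.metric.causalPast 𝒟.toSpacetime.timeOrientation
            (d.flatChart '' {z : d.flatDomain | Te ≤ z.1 0 ∧
              ∀ j, 4 * ρ' j (z.1 0) ≤ (d.background j).radius z.1})

/-- **Residual (K12 frontier brick): rim escape.**  With the antecedents of `CertificateBookkeeping`:
after some flat time `Te`, the flat image of every flat-domain point `y` far from every hole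
(`9ρ'ⱼ(y⁰) ≤ rⱼ y` for all `j`) with `Te ≤ y⁰ ≤ T` lies in the causal past of the flat image of the
far part `{z⁰ = T ∧ ∀ j, 5ρ'ⱼ(z⁰) < rⱼ z}` of the flat slab at time `T`.  (TRUE from the typed
clauses: the flat `C⁴` certificate + `Hc`(4) give asymptotic control of the cone of `Φ`, and an outward
ray in the frame of the nearest hole — cone separation p106992 keeps the others away, sublinearity and
concavity of the profiles keep the growing tubes behind — is a future causal curve inside the late flat
domain reaching the far slab; isolated as a self-contained M–L brick.) -/
def RimEscape : Prop :=
  ∀ (X : Type) [TopologicalSpace X] [ChartedSpace E3 X] [IsManifold (𝓡 3) ∞ X] [ConnectedSpace X]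
    (D : InitialDataSet (𝓡 3) X), D ∈ admissibleVacuumData X →
    ∀ 𝒟 : VacuumCauchyDevelopment D, 𝒟.IsMaximal →
    ∀ (O : Set 𝒟.carrier) (d : FinalStateDecomposition 𝒟.toSpacetime O 4) (R₀ : ℝ),
      O = exteriorOf 𝒟.toCauchyDevelopment d.charted →
      HonestCore 𝒟.toSpacetime O 4 d R₀ → HonestFar 𝒟.toSpacetime O 4 d R₀ →
      DistinctVelocities 𝒟.toSpacetime O 4 d → TubeAnchoredR d R₀ → 0 < d.N →
      ∀ (P : ∀ i, ParityDatum (d.motion i).1) (ρ' : Fin d.N → ℝ → ℝ) (τm R₁ τ₁ τ₂ τn : Fin d.N → ℝ)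
        (W κ Rc κ' : Fin d.N → ℝ → ℝ) (Ψg : ∀ i, (d.background i).domain → 𝒟.carrier)
        (Ψa : ∀ i, (boostedKerrBackground (relabelMotion (P i)) (d.motion i).2 (d.mass i)
          (d.spin i)).domain → 𝒟.carrier),
        (∀ i, AdmissibleProfile d R₀ i (ρ' i) (τm i)) →
        (∀ i, GapCert d R₀ i (fun s ↦ 3 * (16 * ρ' i s) + 2) (R₁ i) (τ₁ i) (W i) (Ψg i)) →
        (∀ i, τ₁ i ≤ τ₂ i ∧ Tendsto (κ i) atTop (𝓝 0) ∧
          Located d i (ρ' i) (τ₁ i) (W i) (Ψg i) (τ₂ i) (κ i) (11 / 10) 46) →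
        (∀ i, SingleHoleCert d R₀ i (P i) (ρ' i) (τ₁ i) (W i) (Ψg i) (τn i) (Rc i) (κ' i) (Ψa i)) →
        ∃ Te : ℝ, ∀ (y : d.flatDomain) (T : ℝ), Te ≤ y.1 0 → y.1 0 ≤ T →
          (∀ j, 9 * ρ' j (y.1 0) ≤ (d.background j).radius y.1) →
          d.flatChart y ∈ 𝒟.toSpacetime.metric.causalPast 𝒟.toSpacetime.timeOrientation
            (d.flatChart '' {z : d.flatDomain | z.1 0 = T ∧
              ∀ j, 5 * ρ' j (z.1 0) < (d.background j).radius z.1})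

end Summit.FinalStateConjecture.FinalStateConjecture.Theorems.GapDecaySuffices.Bookkeeping

end
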